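import Summits.ABC.IUTFork.Repair.CandDupuyHilado3
import Summits.ABC.IUTFork.Repair.ProfileHeight
import HarnessLib

/-!
# IUT REPAIR branch (rung LADDER-ABC:A2.RP) — the «H» COLUMN, row RP-H01c: Dupuy–Hilado's ORDERED composite `Ind2(Ind1((−)^{Ind3}))`
# (`CandDupuyHilado3.HOrder`) EVALUATED on the HEIGHT axis `shellHSetting p h d` (abc-iut-w5-d133, row RP-C02 / PROFILE bed H)

Proof-only companion of `Repair/ProfileHeightColumn` / `ProfileHeightColumnDegree` (seat abc-iut-w5-d133 gen 5; lead abc-iut-rp-plan, GO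
10:15:12Z row list «H01/H01c/H02b»); independent of them (imports only the bed p429379 and abc-iut-rp-h1's record file `Repair/CandDupuyHilado3`).
TAKES NO SIDE on [IUTchIII] Cor. 3.12 or on any author; no definition, no `Prop` fact; `HOrder` is the typed HYPOTHESIS of its record file,
evaluated — never asserted — at a toy bed of the TYPED interface (one place, `l⋇ = 2`, q of height `h`, honest `j²`-scaled Θ-images read through
the log-shell `𝓘_d`, ⟨(Ind1)∪(Ind2)⟩ acting by signs).

THE CELLS (every prime `p`, every `h`, every `d`): on the height axis DH's ORDER of the indeterminacies is IMMATERIAL (`orderImmaterial_height`: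
both DH's ordered family and print's subgroup orbit are the singleton `{B_{h·j² − d}}`), hence **RP-H01c `HOrder` ⟺ RP-H01 `H` ⟺ the typed
Statement ⟺ `3h ≤ 2d`** (`H01c_height_iff`) — the statement half-plane, as RP-H01 (`ProfileHeightColumn.H01_height_iff`). Standard axioms
only. [claim: Mochizuki2012, status: disputed] [cite: DupuyHilado2025, §4.11 ch.16 l.25–31] [cite: ScholzeStix2018, §2.2 pp. 9–10]
-/

noncomputable section

open Set

namespace Summit.ABC.IUTFork.Repair.ProfileHeightColumnOrder

open Thm311 (ThetaIndex LatticeSituation Situation FullSituation)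
open Cor312 Cor312Vol Literature.IUT.LogThetaLattice Cor312.Checks Cor312.IdentifiedNonVacuity Cor312Vol.NaiveWitness
  Cor312Vol.PinnedWitness Cor312Vol.PinnedHonest Summit.ABC.IUTFork.Repair.ProfileHeight Summit.ABC.IUTFork.Repair.CandDupuyHilado3

variable (p : ℕ) (h : ℕ) (d : ℕ) [hp : Fact p.Prime]

omit hp d in
/-- In the height-`h` model every (Ind1)-element and every (Ind2)-element fixes every ball (they act by signs): DH's ordered family at a packet
whose (Ind3)-region is a ball is that ball alone (abc-iut-rp-h1's `possibleImagesDH_eq_singleton_of_ball`, same proof, height-`h` situation).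
[folklore] -/
theorem possibleImagesDH_eq_singleton_of_ball (P : Cor312.Setting (naiveSituationH p h)) {j : toyIndex.Label} {vQ : toyIndex.VQ} {k : ℤ}
    (h3 : P.thetaRegion3 j vQ = pBall p j vQ k) :
    possibleImagesDH (naiveFullH p h).toLatticeSituation P j vQ = {pBall p j vQ k} := by
  ext U
  simp only [Set.mem_singleton_iff]
  constructor
  · rintro ⟨Φ₁, h₁, φ₂, h₂, rfl⟩
    rw [h3]
    have e₁ : Φ₁ vQ '' pBall p j vQ k = pBall p j vQ k := by
      have := image_pBall_of_mem_closure p (Subgroup.subset_closure (Or.inl (extend₁_mem _ h₁))) j vQ k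
      simpa [extend₁] using this
    have e₂ : φ₂ '' pBall p j vQ k = pBall p j vQ k := by
      classical
      have := image_pBall_of_mem_closure p (Subgroup.subset_closure (Or.inr (extend₂_mem _ h₂))) j vQ k
      simpa [extend₂] using this
    rw [e₁, e₂]
  · rintro rfl
    rw [← h3]
    exact thetaRegion3_mem_possibleImagesDH (naiveFullH p h).toLatticeSituation P j vQ

omit hp in
/-- **DH's ORDER IS IMMATERIAL on the height axis** (both families are `{B_{h·j² − d}}`). [folklore] -/
theorem orderImmaterial_height : OrderImmaterial (naiveFullH p h).toLatticeSituation (shellHSetting p h d) := fun j vQ => by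
  rw [possibleImagesDH_eq_singleton_of_ball p h (shellHSetting p h d) (shellH_thetaRegion3 p h d j vQ), shellH_possibleImages]

/-- **RP-H01c** (`CandDupuyHilado3.HOrder`, DH's inequality with DH's order of the indeterminacies): hold-set `{3h ≤ 2d}` = RP-H01's = the typed
Statement's, every `h`. [folklore] -/
theorem H01c_height_iff : HOrder (naiveFullH p h).toLatticeSituation (shellHSetting p h d) ↔ 3 * h ≤ 2 * d :=
  ((HOrder_iff_H_of_orderImmaterial _ _ (orderImmaterial_height p h d)).trans (CandDupuyHilado1.H_iff_statement _ _)).trans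
    (shellH_statement_iff p h d)

/-- DH's `hull(U_Θ)`-volume on the height axis IS print's `−|log(Θ)| = (d − 5h/2)·log p` (order immaterial). [folklore] -/
theorem negLogThetaDH_height :
    negLogThetaDH (naiveFullH p h).toLatticeSituation (shellHSetting p h d) = ((((d : ℝ) - 5 / 2 * h) * Real.log p : ℝ) : WithTop ℝ) := by
  rw [negLogThetaDH_eq_of_orderImmaterial _ _ (orderImmaterial_height p h d), shellH_negLogTheta]

omit h d in
/-- Regimes, RP-H01c (every `h ≥ 1`): at `d = h` it FAILS, at `d = 2h` it HOLDS while the Licence fails, at `d = 3h` both hold — exactly RP-H01's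
(`ProfileHeight.shellH_regimes`). [folklore] -/
theorem H01c_regimes (h₁ : ℕ) (hh : 0 < h₁) :
    ¬ HOrder (naiveFullH p h₁).toLatticeSituation (shellHSetting p h₁ h₁) ∧
      HOrder (naiveFullH p h₁).toLatticeSituation (shellHSetting p h₁ (2 * h₁)) ∧
      HOrder (naiveFullH p h₁).toLatticeSituation (shellHSetting p h₁ (3 * h₁)) := by
  refine ⟨fun hO => ?_, (H01c_height_iff p h₁ (2 * h₁)).2 (by omega), (H01c_height_iff p h₁ (3 * h₁)).2 (by omega)⟩
  have := (H01c_height_iff p h₁ h₁).1 hO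
  omega

end Summit.ABC.IUTFork.Repair.ProfileHeightColumnOrder

end
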